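import Summits.BirchSwinnertonDyer.BirchSwinnertonDyer.Theorems.ResidualThetaTransportAtTwoThetaLayerLambdaCongruenceAtTwoLevelCoeffBound
import Summits.BirchSwinnertonDyer.BirchSwinnertonDyer.Theorems.ResidualThetaTransportAtTwoThetaLayerLambdaCongruenceAtTwoSplitGlue
import HarnessLib

/-!
# Crux `ThetaLayerLambdaCongruenceAtTwo` (stmt-BirchSwinnertonDyer-20688, route ResidualThetaTransportAtTwo), line
# `birth` v8: the registered stub (NR-g) `stub_partnerEulerFactorNonRoot` FROM Deligne's named fact, and the crux from
# (C3k) + (μ-W₁) + Deligne (width seat bsd-wall-rtt-p3-w3 g2; `--supports stmt-BirchSwinnertonDyer-20688 --as helper`;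
# closes nothing)

HONEST FRAMING. THEOREMS ONLY; the input is the tree's NAMED FACT `Deligne1974_heckeT_eigenvalue_norm_le` (Deligne, Weil I,
Thm. 8.2 — Literature, unproved in the tree); nothing about any curve or form is asserted; BSD is not proved by any of this.

WHAT. Skeleton v8 of line `birth` (lead rtt-p3 g3, `0095a66eb2110702`) has three stubs: (C3k) `stub_plusLineCharTwo`, (μ-W₁)
`stub_curveDepletedSymbolMaxAtTwoPowerCusp`, (NR-g) `stub_partnerEulerFactorNonRoot`, glued by the landed
`thetaLayerLambdaCongruenceAtTwo_of_charTwo_curveMax_nonRoot` (`…SplitGlue`). Here: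
* `partnerEulerFactorNonRoot_of_deligne` — the text of (NR-g) VERBATIM, from Deligne's named fact alone (good primes:
  `eval_partnerEulerPolynomial_ne_zero_of_deligne`; level primes: `…_of_levelCoeffBound` + the tree theorem
  `norm_cuspCoeff_le_one_of_dvd_level`). An unconditional proof of (NR-g) in the tree would be a proof of Deligne's theorem.
* `thetaLayerLambdaCongruenceAtTwo_of_charTwo_curveMax_deligne` — THE CRUX BY NAME from (C3k) + (μ-W₁) + Deligne's fact.

References: [Deligne1974] Thm. 8.2; [AtkinLehner1970] Thm. 3.
-/

noncomputable section

-- justification: the `Summit.BirchSwinnertonDyer.BirchSwinnertonDyer.…` path repeats a component (route-file convention)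
set_option linter.dupNamespace false

open scoped Classical MatrixGroups

open Polynomial CongruenceSubgroup Literature.NumberTheory.EllipticCurves Literature.NumberTheory.EllipticCurves.ModularForms

namespace Summit.BirchSwinnertonDyer.BirchSwinnertonDyer.Theorems.ThetaLayerLambdaCongruenceAtTwo

/-- **(NR-g) — the registered stub `stub_partnerEulerFactorNonRoot` of skeleton v8, verbatim — FROM Deligne's named fact**:
for every newform `g` on `Γ₀(M)`, embedding `ι : K_g → ℚ̄₂`, prime `ℓ` and root of unity `ζ ∈ ℚ̄₂`, `P_{g,ℓ}(ζ/ℓ) ≠ 0`.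
[cite: Deligne1974, Thm. (8.2) (the input, as the tree's named fact); AtkinLehner1970, Thm. 3] -/
theorem partnerEulerFactorNonRoot_of_deligne (hD : Deligne1974_heckeT_eigenvalue_norm_le) :
    ∀ (M : ℕ) [NeZero M] (g : CuspForm (CongruenceSubgroup.Gamma0 M) 2) (ι : Literature.NumberTheory.EllipticCurves.ModularForms.coeffField g →+* PadicAlgCl 2), Literature.NumberTheory.EllipticCurves.ModularForms.IsNewform0 g → ∀ ℓ : ℕ, ℓ.Prime → ∀ ζ : PadicAlgCl 2, (∃ m : ℕ, 0 < m ∧ ζ ^ m = 1) → Polynomial.eval (ζ * ((ℓ : PadicAlgCl 2))⁻¹) (1 - Polynomial.C (embCoeff g ι ℓ) * Polynomial.X + (if ℓ ∣ M then 0 else Polynomial.C (ℓ : PadicAlgCl 2)) * Polynomial.X ^ 2 : Polynomial (PadicAlgCl 2)) ≠ 0 := by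
  intro M _ g ι hg ℓ hℓ ζ hζ
  by_cases hℓM : ℓ ∣ M
  · exact eval_partnerEulerPolynomial_ne_zero_of_levelCoeffBound ι hℓ hℓM
      (norm_cuspCoeff_le_one_of_dvd_level hg hℓ hℓM) ζ hζ
  · exact eval_partnerEulerPolynomial_ne_zero_of_deligne ι hD hg hℓ hℓM ζ hζ

/-- **THE CRUX `ThetaLayerLambdaCongruenceAtTwo` BY NAME from (C3k) + (μ-W₁) + DELIGNE'S NAMED FACT** (skeleton v8 with its
third stub discharged modulo `Deligne1974_heckeT_eigenvalue_norm_le`).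
[cite: Deligne1974, Thm. (8.2); GreenbergVatsal2000, §1 (10) (shape; the inputs are hypotheses)] -/
theorem thetaLayerLambdaCongruenceAtTwo_of_charTwo_curveMax_deligne
    (hC3k : ∀ (W : WeierstrassCurve ℚ) [W.IsElliptic] [W.IsGloballyMinimal], Literature.NumberTheory.EllipticCurves.Rank1Residual.GoodSS W 2 → W.Δ < 0 → ∀ (N' : ℕ), Odd N' → (∀ ℓ : ℕ, ℓ.Prime → ℓ ∣ W.conductorNorm ℤ → ℓ ∣ N') → ∀ (k : Type) [Field k] [CharP k 2] (Ψ₁ Ψ₂ : ℚ → k), (∀ (r : ℚ) (z : ℤ), Ψ₁ (r + z) = Ψ₁ r) → (∀ r : ℚ, Ψ₁ (-r) = Ψ₁ r) → (∀ (γ : CongruenceSubgroup.Gamma0 (N')) (r : ℚ), ((γ : SL(2, ℤ)) 1 0 : ℚ) * r + ((γ : SL(2, ℤ)) 1 1 : ℚ) ≠ 0 → Ψ₁ ((((γ : SL(2, ℤ)) 0 0 : ℚ) * r + ((γ : SL(2, ℤ)) 0 1 : ℚ)) / (((γ : SL(2, ℤ)) 1 0 : ℚ) * r + ((γ : SL(2,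 ℤ)) 1 1 : ℚ))) = (if ((γ : SL(2, ℤ)) 1 0) = 0 then 0 else Ψ₁ ((((γ : SL(2, ℤ)) 0 0 : ℚ)) / (((γ : SL(2, ℤ)) 1 0 : ℚ)))) + Ψ₁ r) → (∀ (r : ℚ) (z : ℤ), Ψ₂ (r + z) = Ψ₂ r) → (∀ r : ℚ, Ψ₂ (-r) = Ψ₂ r) → (∀ (γ : CongruenceSubgroup.Gamma0 (N')) (r : ℚ), ((γ : SL(2, ℤ)) 1 0 : ℚ) * r + ((γ : SL(2, ℤ)) 1 1 : ℚ) ≠ 0 → Ψ₂ ((((γ : SL(2, ℤ)) 0 0 : ℚ) * r + ((γ : SL(2, ℤ)) 0 1 : ℚ)) / (((γ : SL(2, ℤ)) 1 0 : ℚ) * r + ((γ : SL(2, ℤ)) 1 1 : ℚ))) = (if ((γ : SL(2, ℤ)) 1 0) = 0 then 0 else Ψ₂ ((((γ : SL(2, ℤ)) 0 0 : ℚ)) / (((γ : SL(2, ℤ)) 1 0 : ℚ)))) + Ψ₂ r) → (∃ r : ℚ, Ψ₁ r ≠ 0) → (∃ r : ℚ, Ψ₂ r ≠ 0) → (∀ q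 : ℕ, q.Prime → ¬ q ∣ N' → ∀ r : ℚ, (∑ j : Fin q, Ψ₁ ((r + j) / q)) + Ψ₁ (q * r) = (W.LFunction q : k) * Ψ₁ r) → (∀ q : ℕ, q.Prime → ¬ q ∣ N' → ∀ r : ℚ, (∑ j : Fin q, Ψ₂ ((r + j) / q)) + Ψ₂ (q * r) = (W.LFunction q : k) * Ψ₂ r) → (∀ ℓ : ℕ, ℓ.Prime → ℓ ∣ N' → ∀ r : ℚ, ∑ j : Fin ℓ, Ψ₁ ((r + j) / ℓ) = 0) → (∀ ℓ : ℕ, ℓ.Prime → ℓ ∣ N' → ∀ r : ℚ, ∑ j : Fin ℓ, Ψ₂ ((r + j) / ℓ) = 0) → ∃ c : k, ∀ r : ℚ, Ψ₂ r = c * Ψ₁ r)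
    (hμW : ∀ (W : WeierstrassCurve ℚ) [W.IsElliptic] [W.IsGloballyMinimal], ¬ W.HasCM → W.analyticRank = 0 → Literature.NumberTheory.EllipticCurves.Rank1Residual.GoodSS W 2 → W.frobeniusTrace 2 = 0 → W.Δ < 0 → ∀ [NeZero (W.conductorNorm ℤ)] (f : CuspForm (CongruenceSubgroup.Gamma0 (W.conductorNorm ℤ)) 2), Literature.NumberTheory.EllipticCurves.ModularForms.IsNewformOf W f → ∀ (S₀ : Finset (IsDedekindDomain.HeightOneSpectrum (NumberField.RingOfIntegers ℚ))), (∀ v ∈ S₀, ((2 : ℕ) : NumberField.RingOfIntegers ℚ) ∉ v.asIdeal) → (∀ v : IsDedekindDomain.HeightOneSpectrum (NumberField.RingOfIntegers ℚ), ¬ W.HasGoodReductionAt v → v ∈ S₀) → ∃ n₁ : ℕ, Even n₁ ∧ ∃ s : ZMod (2 ^ n₁), ∀ r : ℚ, ‖(∑ k ∈ Fintype.piFinset (fun _ : S₀ ↦ Finset.range 3), (∏ v : S₀, ((W.localPolynomialAt (v : IsDedekindDomain.HeightOneSpectrum (NumberField.RingOfIntegers ℚ))).map (Int.castRingHom (PadicAlgCl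 2))).coeff (k v) * ((Rat.HeightOneSpectrum.natGenerator (v : IsDedekindDomain.HeightOneSpectrum (NumberField.RingOfIntegers ℚ)) : PadicAlgCl 2)⁻¹) ^ (k v)) * algebraMap ℚ (PadicAlgCl 2) (ratPlusSymbol f (r * ((∏ v : S₀, Rat.HeightOneSpectrum.natGenerator (v : IsDedekindDomain.HeightOneSpectrum (NumberField.RingOfIntegers ℚ)) ^ (k v) : ℕ) : ℚ))))‖ ≤ ‖(∑ k ∈ Fintype.piFinset (fun _ : S₀ ↦ Finset.range 3), (∏ v : S₀, ((W.localPolynomialAt (v : IsDedekindDomain.HeightOneSpectrum (NumberField.RingOfIntegers ℚ))).map (Int.castRingHom (PadicAlgCl 2))).coeff (k v) * ((Rat.HeightOneSpectrum.natGenerator (v : IsDedekindDomain.HeightOneSpectrum (NumberField.RingOfIntegers ℚ)) : PadicAlgCl 2)⁻¹) ^ (k v)) * algebraMap ℚ (PadicAlgCl 2) (ratPlusSymbol f ((((((Literature.NumberTheory.EllipticCurves.cyclotomicGenerator 2 : ZMod (2 ^ (n₁ + 2))) ^ s.val).val : ℚ) / (2 : ℚ) ^ (n₁ + 2))) * ((∏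 v : S₀, Rat.HeightOneSpectrum.natGenerator (v : IsDedekindDomain.HeightOneSpectrum (NumberField.RingOfIntegers ℚ)) ^ (k v) : ℕ) : ℚ))))‖)
    (hD : Deligne1974_heckeT_eigenvalue_norm_le) :
    Summit.BirchSwinnertonDyer.BirchSwinnertonDyer.Theses.ResidualThetaTransportAtTwo.ThetaLayerLambdaCongruenceAtTwo :=
  thetaLayerLambdaCongruenceAtTwo_of_charTwo_curveMax_nonRoot hC3k hμW (partnerEulerFactorNonRoot_of_deligne hD)

end Summit.BirchSwinnertonDyer.BirchSwinnertonDyer.Theorems.ThetaLayerLambdaCongruenceAtTwo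

end
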